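import Summits.QuantumFields.BalabanUV.Beta.FP.NestedDressingFineLeg

/-!
# `BalabanUV.Beta.FP.NestedDressingDescentLeg` — road «FP» for binder row D1, W-ORACLE-K row **SPLIT, part (iii) «N-DESC» FOR THE MULTIPLIER COLUMNS** (owner d1-p3
# gen 15, memo `HOME/b2b-balaban-beta-d1-p3/N2B-DESIGN.md` v3.1 §11 (11b) (iii) «`Π^{(m+1)}∘liftW = liftW∘Π^{(m),c}`, FILE 1 `qbar_symAxProjNestAt_succ` kernelised»;
# journal [D1P3-G15-WORACLEK]): **ON A LEG WHOSE STRAIGHT `Lc`-AVERAGE IS A MULTIPLE OF A COARSE BOND INDICATOR THE NESTED PROJECTOR IS THE ONE-STEP PROJECTOR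
# MINUS THE LIFTED COARSE NESTED GAUGE OF THAT INDICATOR** — `Π^{(m+1)}_nest A = Π^{(1)}_nest A − c • grad (liftBlk Lc (σ^{(m)} δ_{(μ,y″)}))` whenever `𝒬̄_{Lc} A = c • δ_{(μ,y″)}`
# (FILE 1's recursion, one line); the MULTIPLIER columns of the one-step resolvent are exactly such legs (`𝒬ℋ = δ`: `ResolventComposition.contourSum_Hcol` + the
# semigroup of block-contour sums), at EVERY finite `j` with a `j`-INDEPENDENT coefficient in the road's units, HENCE **for the PERFECT one-step resolvent (`d + 1 = 4`,
# `Lc ≥ 2`, UNCONDITIONAL): `[Π̂_{m+1}·KPerf 1](x, Lc•y″; inl a, inr μ) = [Π̂₁·KPerf 1](x, Lc•y″; inl a, inr μ) − (Lc⁴)⁻¹ · (grad (liftBlk Lc (σ^{(m)} δ_{(μ,y″)})))_a(x)`** —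
# the companion of FILE `NestedDressingFineLeg` ((ii): field legs, correction `0`)

HONEST DEPENDENCY (page 1, mandatory): continuum YM on T⁴ ⇐ BetaPertH ∧ nine spine estimates (0/9 proved); BetaPertH ⇐ (D1) ∧ (D4) ∧ CAP+tail;
G-an2-4 gates asym, D1 and NE2/3/4.  HONEST FRAMING (cell contract, verbatim): «discharging `BetaPertH` makes Bałaban's UV stability UNCONDITIONAL —
a real constructive-QFT result; it is NOT the continuum limit and NOT the Clay problem.»  THIS MODULE is [folklore] finite sums + one passage to an entrywise limit over
LANDED rows: FILE 1 (`symAxProjNestAt`, `symNestGaugeAt_succ`, `symNestGaugeAt_one`, `qbar`, `liftBlk`), FILE 3 `symNestGaugeAt_smul`, FILE 7, this lineage's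
`NestedDressingFineLeg.dressNestLeft_eq_symAxProjNestAt`, gan24-leaf-05's `dressNestLeft_apply`, `PerfectTelescopingFiniteComposite.KTot_inl_inr_zsmul`, `contourSum_Hcol`,
`contourSum_mul`, `sum_LegIdx_eq_contourSum`, `RealRateKMHolds.tendsto_KTot_KPerf_holds`.  No `def`, no `def … : Prop`, nothing cited, nothing of Bałaban's asserted, 0 sorry;
0 estimates of Bałaban's constrained objects; 0∕4 row-D1 binders; NOT the assembled `G_N = G₁ + G_c` (next: composing (i) `NestedDressingDefectKill` + (ii)
`NestedDressingFineLeg` + (iii) this file with (K-fm) `kPerf_column_semigroup` ∕ (K-mm)), NOT SLOT, NOT (SDF), NOT D1, NOT `BetaPertH`, NOT continuum, NOT Clay.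
«not in print; our bookkeeping».

ABSOLUTE RULE (cell charter, verbatim): «No internally-minted statement may enter as a cited fact. Every hypothesis is either kernel-proved in
this package or a verbatim quotation of a PUBLISHED theorem with page reference. The manuscript(s) under audit are NOT citable for their own
disputed steps — they are the thing under adjudication; programme-internal (2001/route/tribunal) claims are never citable.»

WHY (§11 (11b) (iii)).  `Π^{(m+1)}_nest = Π̂₁ − grad ∘ liftBlk ∘ σ^{(m)} ∘ 𝒬̄_{Lc}` (FILE 1's recursion).  On the covariance's field legs `𝒬̄` vanishes ((ii)); on the minimiser
columns `ℋ` it REPRODUCES the coarse bond (`𝒬ℋ = δ`), so there the nested projector differs from `Π̂₁` by the fine gradient of the LIFTED coarse nested gauge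
`σ^{(m)}` of a bond indicator — i.e. by `liftW` of the coarse projector's gauge part `(1 − Π^{(m),c}) δ_{(μ,y″)}` (`grad σ^{(m)} δ = δ − pmSymNest … δ`, FILE 4).  This is the
kernel-level descent the `G_c`-words of row UNLIFT un-lift.

CONTENT (generic `d`; `1 ≤ Lc`, in-block root `r ∈ box (d+1) Lc` where stated).
* §1 Form level: **`symAxProjNestAt_succ_eq_one_sub`** (`Π^{(m+1)} A = Π^{(1)} A − grad (liftBlk Lc (σ^{(m)} (𝒬̄ A)))`), **`symAxProjNestAt_succ_of_qbar_eq_smul`**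
  (`𝒬̄ A = c • X ⇒ Π^{(m+1)} A = Π^{(1)} A − c • grad (liftBlk Lc (σ^{(m)} X))`); kernel legs: **`dressNestLeft_succ_eq_one_sub_of_qbar`**.
* §2 `qbar_KTot_one_inr` — the `𝒬̄`-law of the one-step resolvent's MULTIPLIER column at a coarse point `Lc•y″` (every `j`, any units `unitK uf um`):
  `𝒬̄_{Lc} (col) = (uf·um·((Lc^j)^{d+2})⁻¹·(Lc^{d+1})⁻¹) • δ_{(μ,y″)}`.
* §3 **`dressNestLeft_unitKTot_one_succ_inr_eq`** (EVERY `j`): `[Π̂_{m+1}·U KTot_{(j,1)}](x, Lc•y″; inl a, inr μ) = [Π̂₁·U KTot_{(j,1)}](…) − (uf·um·((Lc^j)^{d+2})⁻¹·(Lc^{d+1})⁻¹)·(grad (liftBlk Lc (σ^{(m)} δ_{(μ,y″)})))_a(x)`.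
* §4 PERFECT (`d + 1 = 4`, `Lc ≥ 2`, road units — the coefficient is `(Lc⁴)⁻¹`, `j`-free): `tendsto_dressNestLeft_unitKTot_one`, **`dressNestLeft_KPerf_one_succ_inr_eq`** (also with
  `piKSymBm`).
Unit `b2b-balaban-beta-d1-formalise-leaf-06` (gen 15), road «FP» row SPLIT (iii) (journal ONLINE 2026-08-21 l.34992, PLAN (1)).
-/

noncomputable section

namespace Summit.QuantumFields.BalabanUV.Beta.FP.NestedDressingDescentLeg

open Finset Filter Topology
open scoped BigOperators
open Literature.MathematicalPhysics.QuantumFieldTheory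
open Literature.MathematicalPhysics.QuantumFieldTheory.Balaban1983to89
open Literature.MathematicalPhysics.QuantumFieldTheory.Balaban1983to89.Beta
open AffineAveraging (Form0 Form1 Site box toSite contourSum)
open AveragingContours (grad)
open AxialProjector (grad_add)
open ExpKernelCalculus (MKer comp)
open OneStepResolventKernel (Fib)
open KernelSpecInstance (wH)
open OneStepKernelFamily (legPt LegIdx)
open StepDriftWitness (sum_LegIdx_eq_contourSum)
open ResolventComposition (Hcol contourSum_Hcol contourSum_mul contourSum_const_mul contourSum_finset_sum)
open Summit.QuantumFields.BalabanUV.Beta.TameKernelCalculus (trK)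
open Summit.QuantumFields.BalabanUV.Beta.AxialDressingRooted (cube)
open Summit.QuantumFields.BalabanUV.Beta.HessKerDressedUnits (unitK unitK_apply legScale legScale_inl legScale_inr)
open Summit.QuantumFields.BalabanUV.Beta.GAN24.CombesThomas (sfStep smStep)
open Summit.QuantumFields.BalabanUV.Beta.GAN24.RealRateKMHolds (tendsto_KTot_KPerf_holds)
open Summit.QuantumFields.BalabanUV.Beta.SymmetrisedDressingMatrix (bondIndR bondIndR_apply)
open Summit.QuantumFields.BalabanUV.Beta.SymmetrisedDressingKernel (piKSymBm)
open Summit.QuantumFields.BalabanUV.Beta.FP.PerfectObjects (KTot)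
open Summit.QuantumFields.BalabanUV.Beta.FP.PerfectObjectsT (KPerf)
open Summit.QuantumFields.BalabanUV.Beta.FP.PerfectTelescopingFiniteComposite (KTot_inl_inr_zsmul)
open Summit.QuantumFields.BalabanUV.Beta.FP.NestedDressingProjector (qbar liftBlk symNestGaugeAt symAxProjNestAt symNestGaugeAt_succ symNestGaugeAt_one
  contourSum_symAxProjNestAt)
open Summit.QuantumFields.BalabanUV.Beta.FP.NestedDressingProjectorBounds (symNestGaugeAt_smul)
open Summit.QuantumFields.BalabanUV.Beta.FP.NestedDressingKernel (pmSymNest piKSymNest piKSymNest_one)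
open Summit.QuantumFields.BalabanUV.Beta.FP.PerfectGaugeDefectBottomDressed (window_reorder dressNestLeft_apply coDressNest_ff_apply)
open Summit.QuantumFields.BalabanUV.Beta.FP.NestedDressingFineLeg (dressNestLeft_eq_symAxProjNestAt contourSum_KTot_one_fst_eq_zero)

variable {d : ℕ}

/-! ## §1 The recursion read as «one-step projector minus the lifted coarse nested gauge of the averaged leg» -/

section Form

/-- [folklore] **FILE 1's RECURSION, PROJECTOR FORM**: `Π^{(m+1)}_nest A = Π^{(1)}_nest A − grad (liftBlk Lc (σ^{(m)} (𝒬̄_{Lc} A)))` (any root, any `Lc`, every `A`). -/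
theorem symAxProjNestAt_succ_eq_one_sub (ρ : Site (d + 1)) (Lc m : ℕ) (A : Form1 (d + 1) ℝ) :
    symAxProjNestAt ρ Lc (m + 1) A = symAxProjNestAt ρ Lc 1 A - grad (liftBlk Lc (symNestGaugeAt ρ Lc m (qbar Lc A))) := by
  rw [symAxProjNestAt, symAxProjNestAt, symNestGaugeAt_succ, symNestGaugeAt_one, grad_add]
  abel

/-- [folklore] `grad` and `liftBlk` are homogeneous. -/
theorem grad_liftBlk_smul (Lc : ℕ) (c : ℝ) (φ : Form0 (d + 1) ℝ) : grad (liftBlk Lc (c • φ)) = c • grad (liftBlk Lc φ) := by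
  funext κ x
  simp only [grad, liftBlk, Pi.smul_apply, smul_eq_mul, mul_sub]

/-- [folklore] **IF THE AVERAGED LEG IS `c • X` THEN `Π^{(m+1)} A = Π^{(1)} A − c • grad (liftBlk Lc (σ^{(m)} X))`** (FILE 3 `symNestGaugeAt_smul`). -/
theorem symAxProjNestAt_succ_of_qbar_eq_smul (ρ : Site (d + 1)) (Lc m : ℕ) {A X : Form1 (d + 1) ℝ} {c : ℝ} (hA : qbar Lc A = c • X) :
    symAxProjNestAt ρ Lc (m + 1) A = symAxProjNestAt ρ Lc 1 A - c • grad (liftBlk Lc (symNestGaugeAt ρ Lc m X)) := by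
  rw [symAxProjNestAt_succ_eq_one_sub, hA, symNestGaugeAt_smul, grad_liftBlk_smul]

/-- [folklore] **KERNEL LEGS** (in-block root, `Lc ≥ 1`): if the first leg of `K(·, y′; ·, f′)` averages to `c • X`, the left dressings by `Π̂_{m+1}` and `Π̂₁` differ by the
lifted coarse nested gauge of `X`: `[Π̂_{m+1}·K](x, y′; inl a, f′) = [Π̂₁·K](x, y′; inl a, f′) − c · (grad (liftBlk Lc (σ^{(m)} X)))_a(x)`. -/
theorem dressNestLeft_succ_eq_one_sub_of_qbar {Lc : ℕ} (hLc : 1 ≤ Lc) {r : Fin (d + 1) → ℕ} (hr : r ∈ box (d + 1) Lc) (m : ℕ) (K : MKer (d + 1) (Fib d))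
    (y' : Site (d + 1)) (f' : Fib d) {X : Form1 (d + 1) ℝ} {c : ℝ} (hK : qbar Lc (fun κ q => K q y' (Sum.inl κ) f') = c • X)
    (x : Site (d + 1)) (a : Fin (d + 1)) :
    comp (trK (piKSymNest (toSite r) Lc (m + 1))) K x y' (Sum.inl a) f'
      = comp (trK (piKSymNest (toSite r) Lc 1)) K x y' (Sum.inl a) f' - c * grad (liftBlk Lc (symNestGaugeAt (toSite r) Lc m X)) a x := by
  rw [dressNestLeft_eq_symAxProjNestAt hLc hr, dressNestLeft_eq_symAxProjNestAt hLc hr, symAxProjNestAt_succ_of_qbar_eq_smul _ _ _ hK]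
  rfl

end Form

/-! ## §2 The one-step resolvent's multiplier column averages to a coarse bond indicator (`𝒬ℋ = δ`), every `j`, any units -/

section Column

variable (Lc : ℕ) [NeZero Lc]

/-- [folklore] The multiplier column of the decimated one-step resolvent at a coarse point, as a block-contour sum of the translated minimiser column:
`KTot_{(j,1)}(q, Lc•y″; inl κ, inr μ) = ((Lc^j)^{d+2})⁻¹ · contourSum (Lc^j) (Hcol_{Lc^(j+1)} μ y″) κ q` (`KTot_inl_inr_zsmul` at `m = 1`). -/
theorem KTot_one_inr_eq_contourSum_Hcol (j : ℕ) (κ μ : Fin (d + 1)) (q y'' : Site (d + 1)) :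
    KTot (d := d) (Lc ^ (j + 1)) (Lc ^ j) q ((Lc : ℤ) • y'') (Sum.inl κ) (Sum.inr μ)
      = ((((Lc ^ j : ℕ) : ℝ)) ^ (d + 2))⁻¹ * contourSum (Lc ^ j) (Hcol (N := Lc ^ (j + 1)) (d := d) μ y'') κ q := by
  have h := KTot_inl_inr_zsmul (d := d) Lc j 1 κ μ q y''
  rw [pow_one] at h
  rw [h, ← sum_LegIdx_eq_contourSum]
  rfl

/-- [folklore] **THE `𝒬̄`-LAW OF THE MULTIPLIER COLUMN** (every `j`, any leg-type-constant units `unitK uf um`): on the step-`j` lattice, the mean-normalised straight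
`Lc`-block averaging of the first leg of the multiplier column at the coarse point `Lc•y″` is
`(uf·um·((Lc^j)^{d+2})⁻¹·(Lc^{d+1})⁻¹) • δ_{(μ,y″)}` — `𝒬_{Lc^(j+1)} ℋ = δ` (`contourSum_Hcol`) through `𝒬_{Lc} ∘ 𝒬_{Lc^j} = 𝒬_{Lc^(j+1)}` (`contourSum_mul`). -/
theorem qbar_KTot_one_inr (hLc : 1 ≤ Lc) (j : ℕ) (uf um : ℝ) (y'' : Site (d + 1)) (μ : Fin (d + 1)) :
    qbar Lc (fun κ q => unitK uf um (KTot (d := d) (Lc ^ (j + 1)) (Lc ^ j)) q ((Lc : ℤ) • y'') (Sum.inl κ) (Sum.inr μ))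
      = (uf * um * ((((Lc ^ j : ℕ) : ℝ)) ^ (d + 2))⁻¹ * (((Lc : ℝ) ^ (d + 1)))⁻¹) • bondIndR μ y'' := by
  have hM : 0 < Lc ^ j := pow_pos (by omega) j
  funext κ Y
  simp only [qbar, unitK_apply, legScale_inl, legScale_inr, KTot_one_inr_eq_contourSum_Hcol, Pi.smul_apply, smul_eq_mul, bondIndR_apply]
  have e : (fun κ q => uf * (((((Lc ^ j : ℕ) : ℝ)) ^ (d + 2))⁻¹ * contourSum (Lc ^ j) (Hcol (N := Lc ^ (j + 1)) (d := d) μ y'') κ q) * um)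
      = fun κ q => (uf * um * ((((Lc ^ j : ℕ) : ℝ)) ^ (d + 2))⁻¹) * contourSum (Lc ^ j) (Hcol (N := Lc ^ (j + 1)) (d := d) μ y'') κ q := by
    funext κ q; ring
  rw [e, contourSum_const_mul, ← congrFun (congrFun (contourSum_mul (Lc ^ j) Lc hM _) κ) Y, ← pow_succ, contourSum_Hcol]
  by_cases h : Y = y'' ∧ κ = μ
  · rw [if_pos h, if_pos ⟨h.2, h.1⟩]; ring
  · rw [if_neg h, if_neg (fun h' => h ⟨h'.2, h'.1⟩)]; ring

end Column

/-! ## §3 SPLIT (iii) for the multiplier columns at every finite `j` -/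

section Finite

variable (Lc : ℕ) [NeZero Lc]

/-- [our proof] **N-DESC AT EVERY FINITE `j`** (every `d`, `Lc ≥ 1`, in-block root, any leg-type-constant units): on the MULTIPLIER column at the coarse point `Lc•y″`,
`[Π̂_{m+1}·U KTot_{(j,1)}](x, Lc•y″; inl a, inr μ) = [Π̂₁·U KTot_{(j,1)}](x, Lc•y″; inl a, inr μ) − (uf·um·((Lc^j)^{d+2})⁻¹·(Lc^{d+1})⁻¹) · (grad (liftBlk Lc (σ^{(m)} δ_{(μ,y″)})))_a(x)`
(`Π̂_M := piKSymNest (toSite r) Lc M`, `σ^{(m)} := symNestGaugeAt (toSite r) Lc m`, `δ_{(μ,y″)} := bondIndR μ y″`). -/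
theorem dressNestLeft_unitKTot_one_succ_inr_eq (hLc : 1 ≤ Lc) {r : Fin (d + 1) → ℕ} (hr : r ∈ box (d + 1) Lc) (m j : ℕ) (uf um : ℝ)
    (x y'' : Site (d + 1)) (a μ : Fin (d + 1)) :
    comp (trK (piKSymNest (toSite r) Lc (m + 1))) (unitK uf um (KTot (d := d) (Lc ^ (j + 1)) (Lc ^ j))) x ((Lc : ℤ) • y'') (Sum.inl a) (Sum.inr μ)
      = comp (trK (piKSymNest (toSite r) Lc 1)) (unitK uf um (KTot (d := d) (Lc ^ (j + 1)) (Lc ^ j))) x ((Lc : ℤ) • y'') (Sum.inl a) (Sum.inr μ)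
        - (uf * um * ((((Lc ^ j : ℕ) : ℝ)) ^ (d + 2))⁻¹ * (((Lc : ℝ) ^ (d + 1)))⁻¹)
          * grad (liftBlk Lc (symNestGaugeAt (toSite r) Lc m (bondIndR μ y''))) a x :=
  dressNestLeft_succ_eq_one_sub_of_qbar hLc hr m _ _ _ (qbar_KTot_one_inr Lc hLc j uf um y'' μ) x a

end Finite

/-! ## §4 SPLIT (iii) for the multiplier columns of the PERFECT one-step resolvent (`d + 1 = 4`, `Lc ≥ 2`, road units: coefficient `(Lc⁴)⁻¹`) -/

section Perfect

variable (Lc : ℕ) [NeZero Lc]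

omit [NeZero Lc] in
/-- [folklore] In the road's units `sfStep Lc j = Lc^j`, `smStep 3 Lc j = Lc^{4j}` the coefficient of §3 is `j`-FREE: `Lc^j · Lc^{4j} · ((Lc^j)^5)⁻¹ · (Lc⁴)⁻¹ = (Lc⁴)⁻¹`. -/
theorem coeff_road_units (hLc : 1 ≤ Lc) (j : ℕ) :
    sfStep Lc j * smStep 3 Lc j * ((((Lc ^ j : ℕ) : ℝ)) ^ (3 + 2))⁻¹ * (((Lc : ℝ) ^ (3 + 1)))⁻¹ = (((Lc : ℝ) ^ (3 + 1)))⁻¹ := by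
  have hL : (Lc : ℝ) ≠ 0 := by exact_mod_cast (show Lc ≠ 0 by omega)
  have hsf : sfStep Lc j = (Lc : ℝ) ^ j := rfl
  have hsm : smStep 3 Lc j = (Lc : ℝ) ^ (j * (3 + 1)) := rfl
  rw [hsf, hsm]
  push_cast
  have h5 : (Lc : ℝ) ^ j * (Lc : ℝ) ^ (j * (3 + 1)) = ((Lc : ℝ) ^ j) ^ (3 + 2) := by ring
  rw [h5, mul_inv_cancel₀ (pow_ne_zero _ (pow_ne_zero _ hL)), one_mul]

/-- [folklore] **THE LEFT DRESSING OF THE RESCALED ONE-STEP RESOLVENTS CONVERGES ENTRYWISE TO THE LEFT DRESSING OF `KPerf 1`** (`d + 1 = 4`, `Lc ≥ 2`; any depth `M`, any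
root): a finite window sum of `RealRateKMHolds.tendsto_KTot_KPerf_holds` limits. -/
theorem tendsto_dressNestLeft_unitKTot_one (hLc : 2 ≤ Lc) (ρ : Fin (3 + 1) → ℤ) (M : ℕ) (x y' : Site (3 + 1)) (a : Fin (3 + 1)) (f' : Fib 3) :
    Tendsto (fun j => comp (trK (piKSymNest ρ Lc M)) (unitK (sfStep Lc j) (smStep 3 Lc j) (KTot (d := 3) (Lc ^ (j + 1)) (Lc ^ j))) x y' (Sum.inl a) f')
      atTop (𝓝 (comp (trK (piKSymNest ρ Lc M)) (KPerf (d := 3) Lc (sfStep Lc) (smStep 3 Lc) 1) x y' (Sum.inl a) f')) := by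
  simp only [dressNestLeft_apply]
  exact tendsto_finsetSum _ fun v _ => tendsto_finsetSum _ fun κ _ =>
    (tendsto_KTot_KPerf_holds hLc (m := 1) le_rfl (x - v) y' (Sum.inl κ) f').const_mul _

/-- [our proof] **SPLIT (iii) «N-DESC» AT THE PERFECT ONE-STEP RESOLVENT — UNCONDITIONAL** (`d + 1 = 4`, `Lc ≥ 2`, in-block root `r ∈ box 4 Lc`, road units): on every
MULTIPLIER column at a coarse point `Lc•y″`,
`[Π̂_{m+1}·KPerf 1](x, Lc•y″; inl a, inr μ) = [Π̂₁·KPerf 1](x, Lc•y″; inl a, inr μ) − (Lc⁴)⁻¹ · (grad (liftBlk Lc (σ^{(m)} δ_{(μ,y″)})))_a(x)`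
— the multiplier-column companion of `NestedDressingFineLeg.dressNestLeft_KPerf_one_succ_eq` (field columns, correction `0`): the nested projector descends through the one-step
minimiser columns to the COARSE nested gauge (memo §11 (11b) (iii)). -/
theorem dressNestLeft_KPerf_one_succ_inr_eq (hLc : 2 ≤ Lc) {r : Fin (3 + 1) → ℕ} (hr : r ∈ box (3 + 1) Lc) (m : ℕ) (x y'' : Site (3 + 1))
    (a μ : Fin (3 + 1)) :
    comp (trK (piKSymNest (toSite r) Lc (m + 1))) (KPerf (d := 3) Lc (sfStep Lc) (smStep 3 Lc) 1) x ((Lc : ℤ) • y'') (Sum.inl a) (Sum.inr μ)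
      = comp (trK (piKSymNest (toSite r) Lc 1)) (KPerf (d := 3) Lc (sfStep Lc) (smStep 3 Lc) 1) x ((Lc : ℤ) • y'') (Sum.inl a) (Sum.inr μ)
        - (((Lc : ℝ) ^ (3 + 1)))⁻¹ * grad (liftBlk Lc (symNestGaugeAt (toSite r) Lc m (bondIndR μ y''))) a x := by
  have hLc1 : 1 ≤ Lc := by omega
  have tL := tendsto_dressNestLeft_unitKTot_one Lc hLc (toSite r) (m + 1) x ((Lc : ℤ) • y'') a (Sum.inr μ)
  have tR := (tendsto_dressNestLeft_unitKTot_one Lc hLc (toSite r) 1 x ((Lc : ℤ) • y'') a (Sum.inr μ)).sub_const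
    ((((Lc : ℝ) ^ (3 + 1)))⁻¹ * grad (liftBlk Lc (symNestGaugeAt (toSite r) Lc m (bondIndR μ y''))) a x)
  refine tendsto_nhds_unique tL (tR.congr fun j => ?_)
  rw [dressNestLeft_unitKTot_one_succ_inr_eq Lc hLc1 hr m j, coeff_road_units Lc hLc1 j]

/-- [our proof] The same with an2's one-step kernel `piKSymBm` (the literal's `Π̂₁`, FILE 4 `piKSymNest_one`) on the right. -/
theorem dressNestLeft_KPerf_one_succ_inr_eq_piKSymBm (hLc : 2 ≤ Lc) {r : Fin (3 + 1) → ℕ} (hr : r ∈ box (3 + 1) Lc) (m : ℕ) (x y'' : Site (3 + 1))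
    (a μ : Fin (3 + 1)) :
    comp (trK (piKSymNest (toSite r) Lc (m + 1))) (KPerf (d := 3) Lc (sfStep Lc) (smStep 3 Lc) 1) x ((Lc : ℤ) • y'') (Sum.inl a) (Sum.inr μ)
      = comp (trK (piKSymBm (toSite r) Lc)) (KPerf (d := 3) Lc (sfStep Lc) (smStep 3 Lc) 1) x ((Lc : ℤ) • y'') (Sum.inl a) (Sum.inr μ)
        - (((Lc : ℝ) ^ (3 + 1)))⁻¹ * grad (liftBlk Lc (symNestGaugeAt (toSite r) Lc m (bondIndR μ y''))) a x := by
  rw [dressNestLeft_KPerf_one_succ_inr_eq Lc hLc hr, piKSymNest_one]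

end Perfect

/-! ## §5 Letters for row TRANSPORT's (F-kill) (leaf-02 g15 L-d1leaf02g15-1): the one-step-co-dressed covariance's field legs stay `𝒬_{Lc}`-killed -/

section FKill

variable (Lc : ℕ) [NeZero Lc]

omit [NeZero Lc] in
/-- [folklore] **THE ONE-STEP CO-DRESSING KEEPS THE FIRST FIELD LEG `𝒬_{Lc}`-KILLED** (`Lc ≥ 1`, in-block root, ANY kernel `K` whose first field legs are
`𝒬_{Lc}`-killed): `contourSum Lc ((κ, q) ↦ [Π̂₁·K·Π̂₁ᵀ](q, z; inl κ, inl b)) = 0` — FILE 1 `contourSum_symAxProjNestAt` at `m = 1` (the block-mean-normalised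
projector is invisible to the straight averaging, an2's `contourSum_symAxProjBmAt`) after the right window contraction (finite sums).  The `q·[G₁]_ff·qᵀ = 0` letter of
leaf-02's (F-kill). -/
theorem contourSum_coDressNest_one_fst_eq_zero (hLc : 1 ≤ Lc) {r : Fin (d + 1) → ℕ} (hr : r ∈ box (d + 1) Lc) (K : MKer (d + 1) (Fib d))
    (hK : ∀ (y' : Site (d + 1)) (l : Fin (d + 1)), contourSum Lc (fun κ q => K q y' (Sum.inl κ) (Sum.inl l)) = 0) (z : Site (d + 1)) (b : Fin (d + 1)) :
    contourSum Lc (fun κ q => comp (comp (trK (piKSymNest (toSite r) Lc 1)) K) (piKSymNest (toSite r) Lc 1) q z (Sum.inl κ) (Sum.inl b)) = 0 := by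
  -- the entry as the right window contraction of the left-dressed kernel
  have e : (fun κ q => comp (comp (trK (piKSymNest (toSite r) Lc 1)) K) (piKSymNest (toSite r) Lc 1) q z (Sum.inl κ) (Sum.inl b))
      = fun κ q => ∑ w ∈ cube (d + 1) (Lc ^ 1), ∑ l : Fin (d + 1),
          pmSymNest (toSite r) Lc 1 b z l (z - w) * comp (trK (piKSymNest (toSite r) Lc 1)) K q (z - w) (Sum.inl κ) (Sum.inl l) := by
    funext κ q
    rw [coDressNest_ff_apply,
      ← window_reorder (cube (d + 1) (Lc ^ 1)) (cube (d + 1) (Lc ^ 1))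
        (fun v κ' w l => pmSymNest (toSite r) Lc 1 κ q κ' (q - v) * K (q - v) (z - w) (Sum.inl κ') (Sum.inl l))
        (fun w l => pmSymNest (toSite r) Lc 1 b z l (z - w))]
    simp only [dressNestLeft_apply]
    exact Finset.sum_congr rfl fun w _ => Finset.sum_congr rfl fun l _ => mul_comm _ _
  rw [e]
  funext κ Y
  rw [contourSum_finset_sum]
  simp only [contourSum_finset_sum, contourSum_const_mul]
  refine Finset.sum_eq_zero fun w _ => Finset.sum_eq_zero fun l _ => ?_
  -- the left-dressed column is `Π̂₁` of a `𝒬`-killed leg, whose `contourSum Lc` is that of the leg (FILE 1, `m = 1`)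
  have h : contourSum Lc (fun κ q => comp (trK (piKSymNest (toSite r) Lc 1)) K q (z - w) (Sum.inl κ) (Sum.inl l)) = 0 := by
    have hF : (fun κ q => comp (trK (piKSymNest (toSite r) Lc 1)) K q (z - w) (Sum.inl κ) (Sum.inl l))
        = symAxProjNestAt (toSite r) Lc 1 (fun κ q => K q (z - w) (Sum.inl κ) (Sum.inl l)) := by
      funext κ q; exact dressNestLeft_eq_symAxProjNestAt hLc hr 1 K q (z - w) κ (Sum.inl l)
    rw [hF, ← pow_one Lc, show Lc ^ 1 = Lc from pow_one Lc]
    have h1 := contourSum_symAxProjNestAt hLc (toSite r) 1 (fun κ q => K q (z - w) (Sum.inl κ) (Sum.inl l))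
    rw [pow_one] at h1
    rw [h1, hK]
  rw [h]
  simp

/-- [folklore] **THE PERFECT ONE-STEP COVARIANCE's FIELD LEGS ARE `𝒬_{Lc}`-KILLED** (`d + 1 = 4`, `Lc ≥ 2`; a finite contour sum of `tendsto_KTot_KPerf_holds` limits of
`NestedDressingFineLeg.contourSum_KTot_one_fst_eq_zero`): `contourSum Lc ((κ, q) ↦ KPerf 1 (q, y′; inl κ, inl l)) = 0`. -/
theorem contourSum_KPerf_one_fst_eq_zero (hLc : 2 ≤ Lc) (y' : Site (3 + 1)) (l : Fin (3 + 1)) :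
    contourSum Lc (fun κ q => KPerf (d := 3) Lc (sfStep Lc) (smStep 3 Lc) 1 q y' (Sum.inl κ) (Sum.inl l)) = 0 := by
  funext κ Y
  have t : Tendsto (fun j => contourSum Lc (fun κ q => unitK (sfStep Lc j) (smStep 3 Lc j) (KTot (d := 3) (Lc ^ (j + 1)) (Lc ^ j)) q y' (Sum.inl κ) (Sum.inl l)) κ Y)
      atTop (𝓝 (contourSum Lc (fun κ q => KPerf (d := 3) Lc (sfStep Lc) (smStep 3 Lc) 1 q y' (Sum.inl κ) (Sum.inl l)) κ Y)) := by
    simp only [contourSum]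
    exact tendsto_finsetSum _ fun bb _ => tendsto_finsetSum _ fun s _ => tendsto_KTot_KPerf_holds hLc (m := 1) le_rfl _ y' (Sum.inl κ) (Sum.inl l)
  have t0 : Tendsto (fun j => contourSum Lc (fun κ q => unitK (sfStep Lc j) (smStep 3 Lc j) (KTot (d := 3) (Lc ^ (j + 1)) (Lc ^ j)) q y' (Sum.inl κ) (Sum.inl l)) κ Y)
      atTop (𝓝 0) := by
    refine tendsto_const_nhds.congr fun j => ?_
    rw [contourSum_KTot_one_fst_eq_zero Lc (by omega) j]
    rfl
  exact tendsto_nhds_unique t t0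

/-- [our proof] **(F-kill) AT THE PERFECT OBJECTS — UNCONDITIONAL** (`d + 1 = 4`, `Lc ≥ 2`, in-block root): the one-step-co-dressed perfect covariance's first field leg is
`𝒬_{Lc}`-killed, `contourSum Lc ((κ, q) ↦ [Π̂₁·KPerf 1·Π̂₁ᵀ](q, z; inl κ, inl b)) = 0` (`Π̂₁ := piKSymNest (toSite r) Lc 1 = piKSymBm (toSite r) Lc`). -/
theorem contourSum_coDressNest_one_KPerf_one_fst_eq_zero (hLc : 2 ≤ Lc) {r : Fin (3 + 1) → ℕ} (hr : r ∈ box (3 + 1) Lc) (z : Site (3 + 1)) (b : Fin (3 + 1)) :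
    contourSum Lc (fun κ q => comp (comp (trK (piKSymNest (toSite r) Lc 1)) (KPerf (d := 3) Lc (sfStep Lc) (smStep 3 Lc) 1)) (piKSymNest (toSite r) Lc 1)
      q z (Sum.inl κ) (Sum.inl b)) = 0 :=
  contourSum_coDressNest_one_fst_eq_zero Lc (by omega) hr _ (fun y' l => contourSum_KPerf_one_fst_eq_zero Lc hLc y' l) z b

end FKill

/-! ## §6 (F-kill) in the SECOND field leg (OWNER R-FP-48 [D1P3-G16-RFP48]: «the second-leg twins: yes — TRANSPORT′∕KILL consume both») -/

section FKill2

variable (Lc : ℕ) [NeZero Lc]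

omit [NeZero Lc] in
/-- [folklore] **THE ONE-STEP CO-DRESSING KEEPS THE SECOND FIELD LEG `𝒬_{Lc}`-KILLED** (`Lc ≥ 1`, in-block root, ANY kernel `K` whose second field legs are
`𝒬_{Lc}`-killed): `contourSum Lc ((b, z) ↦ [Π̂₁·K·Π̂₁ᵀ](x, z; inl a, inl b)) = 0` — as a function of its second leg the co-dressed entry is `Π^{(1)}` of the left-dressed column
(`coDressNest_ff_apply` + `window_reorder` + FILE 7), FILE 1 `contourSum_symAxProjNestAt` at `m = 1`, then `NestedDressingFineLeg.contourSum_dressNestLeft_snd_eq_zero`. -/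
theorem contourSum_coDressNest_one_snd_eq_zero (hLc : 1 ≤ Lc) {r : Fin (d + 1) → ℕ} (hr : r ∈ box (d + 1) Lc) (K : MKer (d + 1) (Fib d))
    (hK : ∀ (x' : Site (d + 1)) (κ : Fin (d + 1)), contourSum Lc (fun l q => K x' q (Sum.inl κ) (Sum.inl l)) = 0) (x : Site (d + 1)) (a : Fin (d + 1)) :
    contourSum Lc (fun b z => comp (comp (trK (piKSymNest (toSite r) Lc 1)) K) (piKSymNest (toSite r) Lc 1) x z (Sum.inl a) (Sum.inl b)) = 0 := by
  have e : (fun b z => comp (comp (trK (piKSymNest (toSite r) Lc 1)) K) (piKSymNest (toSite r) Lc 1) x z (Sum.inl a) (Sum.inl b))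
      = symAxProjNestAt (toSite r) Lc 1 (fun l q => comp (trK (piKSymNest (toSite r) Lc 1)) K x q (Sum.inl a) (Sum.inl l)) := by
    funext b z
    rw [coDressNest_ff_apply, Summit.QuantumFields.BalabanUV.Beta.FP.NestedDressingLinear.symAxProjNestAt_eq_coProjNestAt hLc hr,
      ← window_reorder (cube (d + 1) (Lc ^ 1)) (cube (d + 1) (Lc ^ 1))
        (fun v κ w l => pmSymNest (toSite r) Lc 1 a x κ (x - v) * K (x - v) (z - w) (Sum.inl κ) (Sum.inl l))
        (fun w l => pmSymNest (toSite r) Lc 1 b z l (z - w))]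
    simp only [Summit.QuantumFields.BalabanUV.Beta.FP.NestedDressingLinear.coProjNestAt, dressNestLeft_apply]
    exact Finset.sum_congr rfl fun w _ => Finset.sum_congr rfl fun l _ => mul_comm _ _
  have h1 := contourSum_symAxProjNestAt hLc (toSite r) 1 (fun l q => comp (trK (piKSymNest (toSite r) Lc 1)) K x q (Sum.inl a) (Sum.inl l))
  rw [pow_one] at h1
  rw [e, h1]
  exact Summit.QuantumFields.BalabanUV.Beta.FP.NestedDressingFineLeg.contourSum_dressNestLeft_snd_eq_zero (toSite r) Lc 1 K hK x a

/-- [folklore] **THE PERFECT ONE-STEP COVARIANCE's SECOND FIELD LEG IS `𝒬_{Lc}`-KILLED** (`d + 1 = 4`, `Lc ≥ 2`; a finite contour sum of `tendsto_KTot_KPerf_holds` limits of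
`NestedDressingFineLeg.contourSum_KTot_one_snd_eq_zero`). -/
theorem contourSum_KPerf_one_snd_eq_zero (hLc : 2 ≤ Lc) (x' : Site (3 + 1)) (κ : Fin (3 + 1)) :
    contourSum Lc (fun l q => KPerf (d := 3) Lc (sfStep Lc) (smStep 3 Lc) 1 x' q (Sum.inl κ) (Sum.inl l)) = 0 := by
  funext l Y
  have t : Tendsto (fun j => contourSum Lc (fun l q => unitK (sfStep Lc j) (smStep 3 Lc j) (KTot (d := 3) (Lc ^ (j + 1)) (Lc ^ j)) x' q (Sum.inl κ) (Sum.inl l)) l Y)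
      atTop (𝓝 (contourSum Lc (fun l q => KPerf (d := 3) Lc (sfStep Lc) (smStep 3 Lc) 1 x' q (Sum.inl κ) (Sum.inl l)) l Y)) := by
    simp only [contourSum]
    exact tendsto_finsetSum _ fun bb _ => tendsto_finsetSum _ fun s _ => tendsto_KTot_KPerf_holds hLc (m := 1) le_rfl x' _ (Sum.inl κ) (Sum.inl l)
  have t0 : Tendsto (fun j => contourSum Lc (fun l q => unitK (sfStep Lc j) (smStep 3 Lc j) (KTot (d := 3) (Lc ^ (j + 1)) (Lc ^ j)) x' q (Sum.inl κ) (Sum.inl l)) l Y)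
      atTop (𝓝 0) := by
    refine tendsto_const_nhds.congr fun j => ?_
    rw [Summit.QuantumFields.BalabanUV.Beta.FP.NestedDressingFineLeg.contourSum_KTot_one_snd_eq_zero Lc (by omega) j]
    rfl
  exact tendsto_nhds_unique t t0

/-- [our proof] **(F-kill), SECOND LEG, AT THE PERFECT OBJECTS — UNCONDITIONAL** (`d + 1 = 4`, `Lc ≥ 2`, in-block root):
`contourSum Lc ((b, z) ↦ [Π̂₁·KPerf 1·Π̂₁ᵀ](x, z; inl a, inl b)) = 0`. -/
theorem contourSum_coDressNest_one_KPerf_one_snd_eq_zero (hLc : 2 ≤ Lc) {r : Fin (3 + 1) → ℕ} (hr : r ∈ box (3 + 1) Lc) (x : Site (3 + 1)) (a : Fin (3 + 1)) :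
    contourSum Lc (fun b z => comp (comp (trK (piKSymNest (toSite r) Lc 1)) (KPerf (d := 3) Lc (sfStep Lc) (smStep 3 Lc) 1)) (piKSymNest (toSite r) Lc 1)
      x z (Sum.inl a) (Sum.inl b)) = 0 :=
  contourSum_coDressNest_one_snd_eq_zero Lc (by omega) hr _ (fun x' κ => contourSum_KPerf_one_snd_eq_zero Lc hLc x' κ) x a

end FKill2

end Summit.QuantumFields.BalabanUV.Beta.FP.NestedDressingDescentLeg

end
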